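import Mathlib
import Summits.Ventures.PercRepro2.Defs
import Summits.Ventures.PercRepro2.Graph
import Summits.Ventures.PercRepro2.Induced
import Summits.Ventures.PercRepro2.VdBKahn
import Summits.Ventures.PercRepro2.ReimerVdBK
import Summits.Ventures.PercRepro2.ReimerVdBKRegions
import Summits.Ventures.PercRepro2.ReimerVdBKZClosed
import Summits.Ventures.PercRepro2.ReimerVdBKZReduction
import Summits.Ventures.PercRepro2.ReimerVdBKZSplit

/-!
# Type weights: the two-world counts as products of per-vertex weights, and their one-edge split
(blind cell PercRepro2, mine-c g46; `conjectures/MINE-C.md` §55.3)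

A vertex of a 2-colouring has one of four TYPES — in both worlds (`C`), in world 1 only (`P₁`), in world 2
only (`P₂`), in neither (`O`).  A TYPE WEIGHT `w : TW = ℕ × ℕ × ℕ × ℕ` assigns a weight to each type, and for
an assignment `W : V → TW` the weighted count is `pcount W = ∑_ω ∏_v (W v)(type_ω v)`.  Every two-world count
is such a product count: a vertex of `A` carries `(1,1,0,0)`, of `X` `(0,0,1,1)`, of `B` `(1,0,1,0)`, of `Y`
`(0,1,0,1)`, an unmarked vertex `(1,1,1,1)`, and the weights of several marks multiply (`tmul`).

THE ONE-EDGE SPLIT (`pcount_split`): if `z ≠ s` carries weight only on the type `O` (it is avoided by both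
worlds) and `e = {z, y}` is an edge, then turning `e` into a loop and multiplying the weight of `y` by
`(0, 1, 1, 2)` doubles the count.  With `pcount_tadd` (weights add) and `pcount_smul` (weights scale) this is
the whole algebra of the Z-reduction (`MINE-C.md` §54.6, §55.0): `ReimerVdBKCoreDown` iterates it to the
reduction of (R-1.2) to its Harris-pair core.
-/

namespace Summit.Ventures.PercRepro2
namespace ReimerVdBK
open Classical

/-! ## Type weights -/

/-- A weight on the four types of a vertex: (both worlds, world 1 only, world 2 only, neither). -/
abbrev TW := ℕ × ℕ × ℕ × ℕ

/-- The weight of the type `(b₁, b₂)` = (in world 1?, in world 2?). -/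
def tw (w : TW) (b₁ b₂ : Bool) : ℕ :=
  match b₁, b₂ with
  | true, true => w.1
  | true, false => w.2.1
  | false, true => w.2.2.1
  | false, false => w.2.2.2

/-- Componentwise product of type weights. -/
def tmul (w w' : TW) : TW := (w.1 * w'.1, w.2.1 * w'.2.1, w.2.2.1 * w'.2.2.1, w.2.2.2 * w'.2.2.2)

/-- Componentwise sum of type weights. -/
def tadd (w w' : TW) : TW := (w.1 + w'.1, w.2.1 + w'.2.1, w.2.2.1 + w'.2.2.1, w.2.2.2 + w'.2.2.2)

/-- Scalar multiple of a type weight. -/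
def tsmul (c : ℕ) (w : TW) : TW := (c * w.1, c * w.2.1, c * w.2.2.1, c * w.2.2.2)

/-- The split weight `(0, 1, 1, 2)`: `[not in world 1] + [not in world 2]`. -/
def tSplit : TW := (0, 1, 1, 2)

/-- `tw` of a product is the product of the `tw`s. -/
lemma tw_tmul (w w' : TW) (b₁ b₂ : Bool) : tw (tmul w w') b₁ b₂ = tw w b₁ b₂ * tw w' b₁ b₂ := by
  cases b₁ <;> cases b₂ <;> rfl

/-- `tw` of a sum is the sum of the `tw`s. -/
lemma tw_tadd (w w' : TW) (b₁ b₂ : Bool) : tw (tadd w w') b₁ b₂ = tw w b₁ b₂ + tw w' b₁ b₂ := by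
  cases b₁ <;> cases b₂ <;> rfl

/-- `tw` of a scalar multiple. -/
lemma tw_tsmul (c : ℕ) (w : TW) (b₁ b₂ : Bool) : tw (tsmul c w) b₁ b₂ = c * tw w b₁ b₂ := by
  cases b₁ <;> cases b₂ <;> rfl

/-- The classical truth value of a proposition (always the classical instance, so that the weights carry no
decidability assumptions). -/
noncomputable def cdec (p : Prop) : Bool := @decide p (Classical.propDecidable p)

/-- `cdec` of a true proposition. -/
lemma cdec_eq_true {p : Prop} (h : p) : cdec p = true := decide_eq_true h

/-- `cdec` of a false proposition. -/
lemma cdec_eq_false {p : Prop} (h : ¬ p) : cdec p = false := decide_eq_false h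

/-- `cdec` respects equivalence. -/
lemma cdec_congr {p q : Prop} (h : p ↔ q) : cdec p = cdec q := by
  by_cases hp : p
  · rw [cdec_eq_true hp, cdec_eq_true (h.1 hp)]
  · rw [cdec_eq_false hp, cdec_eq_false (fun hq => hp (h.2 hq))]

/-- The indicator of `¬ p`. -/
noncomputable def notInd (p : Prop) : ℕ := if cdec p then 0 else 1

/-- `notInd` of a true proposition. -/
lemma notInd_of {p : Prop} (hp : p) : notInd p = 0 := by simp [notInd, cdec_eq_true hp]

/-- `notInd` of a false proposition. -/
lemma notInd_of_not {p : Prop} (hp : ¬ p) : notInd p = 1 := by simp [notInd, cdec_eq_false hp]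

/-- The split weight is `[¬b₁] + [¬b₂]`. -/
lemma tw_tSplit (b₁ b₂ : Bool) :
    tw tSplit b₁ b₂ = (if b₁ then 0 else 1) + (if b₂ then 0 else 1) := by
  cases b₁ <;> cases b₂ <;> rfl

/-- The split weight at classical truth values is the sum of the two `notInd`s. -/
lemma tw_tSplit_cdec (p q : Prop) : tw tSplit (cdec p) (cdec q) = notInd p + notInd q := by
  rw [tw_tSplit]; rfl

variable {V : Type*} {E : Type*} [Fintype E] [DecidableEq E] [Fintype V] [DecidableEq V]
variable (ends : E → Sym2 V) (s : V)

/-! ## Weighted counts -/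

/-- The weight of the vertex `v` in the colouring `ω` under the assignment `W`. -/
noncomputable def vw (W : V → TW) (ω : Config E) (v : V) : ℕ :=
  tw (W v) (cdec (Conn ends ω s v)) (cdec (Conn ends (compl ω) s v))

/-- The weighted two-world count `∑_ω ∏_v (W v)(type_ω v)`. -/
noncomputable def pcount (W : V → TW) : ℕ := ∑ ω : Config E, ∏ v : V, vw ends s W ω v

omit [Fintype E] [DecidableEq E] [Fintype V] in
/-- The weight of `v` under an assignment changed at `v`. -/
lemma vw_update_self (W : V → TW) (v : V) (w : TW) (ω : Config E) :
    vw ends s (Function.update W v w) ω v =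
      tw w (cdec (Conn ends ω s v)) (cdec (Conn ends (compl ω) s v)) := by
  simp [vw]

omit [Fintype E] [DecidableEq E] [Fintype V] in
/-- The weight of `u ≠ v` is unchanged by an update at `v`. -/
lemma vw_update_of_ne (W : V → TW) {u v : V} (huv : u ≠ v) (w : TW) (ω : Config E) :
    vw ends s (Function.update W v w) ω u = vw ends s W ω u := by
  simp [vw, Function.update_of_ne huv]

omit [Fintype E] [DecidableEq E] in
/-- The product of the weights, split at one vertex. -/
lemma prod_vw_update (W : V → TW) (v : V) (w : TW) (ω : Config E) :
    ∏ u : V, vw ends s (Function.update W v w) ω u =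
      tw w (cdec (Conn ends ω s v)) (cdec (Conn ends (compl ω) s v)) *
        ∏ u ∈ Finset.univ.erase v, vw ends s W ω u := by
  rw [← Finset.mul_prod_erase Finset.univ _ (Finset.mem_univ v), vw_update_self]
  congr 1
  exact Finset.prod_congr rfl fun u hu => vw_update_of_ne ends s W (Finset.ne_of_mem_erase hu) w ω

/-- **Weights add**: `pcount (W[v ↦ w + w']) = pcount (W[v ↦ w]) + pcount (W[v ↦ w'])`. -/
lemma pcount_tadd (W : V → TW) (v : V) (w w' : TW) :
    pcount ends s (Function.update W v (tadd w w')) =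
      pcount ends s (Function.update W v w) + pcount ends s (Function.update W v w') := by
  unfold pcount
  rw [← Finset.sum_add_distrib]
  refine Finset.sum_congr rfl fun ω _ => ?_
  rw [prod_vw_update, prod_vw_update, prod_vw_update, tw_tadd, add_mul]

/-- **Weights scale**: `pcount (W[v ↦ c • w]) = c * pcount (W[v ↦ w])`. -/
lemma pcount_tsmul (W : V → TW) (v : V) (c : ℕ) (w : TW) :
    pcount ends s (Function.update W v (tsmul c w)) = c * pcount ends s (Function.update W v w) := by
  unfold pcount
  rw [Finset.mul_sum]
  refine Finset.sum_congr rfl fun ω _ => ?_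
  rw [prod_vw_update, prod_vw_update, tw_tsmul, mul_assoc]

omit [DecidableEq V] in
/-- Assignments with the same vertex weights have the same count. -/
lemma pcount_congr (W W' : V → TW) (h : ∀ ω v, vw ends s W ω v = vw ends s W' ω v) :
    pcount ends s W = pcount ends s W' := by
  unfold pcount
  exact Finset.sum_congr rfl fun ω _ => Finset.prod_congr rfl fun v _ => h ω v

omit [DecidableEq V] in
/-- An assignment with the zero weight at some vertex counts nothing. -/
lemma pcount_eq_zero_of_zero (W : V → TW) (v : V) (hv : W v = (0, 0, 0, 0)) :
    pcount ends s W = 0 := by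
  unfold pcount
  refine Finset.sum_eq_zero fun ω _ => ?_
  refine Finset.prod_eq_zero (Finset.mem_univ v) ?_
  unfold vw
  rw [hv]
  cases cdec (Conn ends ω s v) <;> cases cdec (Conn ends (compl ω) s v) <;> rfl

omit [DecidableEq V] in
/-- The root is in both worlds: an assignment whose root weight vanishes on the type `C` counts nothing. -/
lemma pcount_eq_zero_of_root (W : V → TW) (hs : (W s).1 = 0) : pcount ends s W = 0 := by
  unfold pcount
  refine Finset.sum_eq_zero fun ω _ => ?_
  refine Finset.prod_eq_zero (Finset.mem_univ s) ?_
  unfold vw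
  rw [cdec_eq_true (conn_refl ends ω s), cdec_eq_true (conn_refl ends (compl ω) s)]
  exact hs

/-! ## Blindness to one edge -/

omit [Fintype V] [DecidableEq V] in
/-- A function blind to the edge `e` has the same sum over the configurations with `e` of either colour. -/
lemma sum_filter_eq_half (f : Config E → ℕ) (e : E)
    (hf : ∀ ω b, f (Function.update ω e b) = f ω) (b : Bool) :
    2 * ∑ ω : Config E, (if ω e = b then f ω else 0) = ∑ ω : Config E, f ω := by
  have h := sum_flip e (fun ω => (f ω : ℚ)) (fun _ b' => if b' = b then (1 : ℚ) else 0)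
    (fun ω b' => by simp only [hf]) (fun _ _ _ => rfl)
  have h1 : ∀ ω : Config E, (f ω : ℚ) * ((if true = b then (1 : ℚ) else 0) + (if false = b then 1 else 0))
      = f ω := by
    intro ω; cases b <;> simp
  have h2 : ∀ ω : Config E, (f ω : ℚ) * (if ω e = b then (1 : ℚ) else 0) =
      ((if ω e = b then f ω else 0 : ℕ) : ℚ) := by
    intro ω
    by_cases hb : ω e = b <;> simp [hb]
  simp only [h1, h2] at h
  exact_mod_cast h

/-! ## The one-edge split -/

omit [Fintype E] [Fintype V] [DecidableEq V] in
/-- The weights of the looped graph are blind to the colour of the looped edge. -/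
lemma vw_loopAt_update (W : V → TW) (e : E) (z : V) (ω : Config E) (b : Bool) (v : V) :
    vw (loopAt ends e z) s W (Function.update ω e b) v = vw (loopAt ends e z) s W ω v := by
  unfold vw
  rw [conn_loopAt_iff, conn_loopAt_iff, Function.update_idem, compl_update_eq, conn_loopAt_iff,
    conn_loopAt_iff, Function.update_idem]

omit [Fintype E] [Fintype V] [DecidableEq V] in
/-- The weight of `v` in the looped graph, spelled out. -/
lemma vw_loopAt (W : V → TW) (e : E) (z : V) (ω : Config E) (v : V) :
    vw (loopAt ends e z) s W ω v =
      tw (W v) (cdec (Conn ends (Function.update ω e false) s v))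
        (cdec (Conn ends (Function.update (compl ω) e false) s v)) := by
  unfold vw
  rw [conn_loopAt_iff, conn_loopAt_iff]

omit [Fintype E] [DecidableEq V] in
/-- **The per-colouring split, world 1.**  If `z ≠ s` carries weight only on the type `O` and
`e = {z, y}` is open in world 1, the product of the weights on `G` is the product on the looped graph
times `[y ∉ K₁']`. -/
lemma prod_vw_split_true (W : V → TW) {z y : V} {e : E} (hends : ends e = s(z, y)) (hsz : s ≠ z)
    (hz : (W z).1 = 0 ∧ (W z).2.1 = 0) {ω : Config E} (he : ω e = true) :
    ∏ v : V, vw ends s W ω v =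
      notInd (Conn ends (Function.update ω e false) s y) *
        ∏ v : V, vw (loopAt ends e z) s W ω v := by
  have hze : z ∈ ends e := by rw [hends]; exact Sym2.mem_mk_left z y
  have hc : compl ω e = false := by simp [compl, he]
  have hupd : Function.update (compl ω) e false = compl ω := by
    conv_rhs => rw [← Function.update_eq_self e (compl ω)]
    rw [hc]
  by_cases hzK : Conn ends ω s z
  · -- `z` is reached: the left product vanishes, and so does the right side
    have hL : ∏ v : V, vw ends s W ω v = 0 := by
      refine Finset.prod_eq_zero (Finset.mem_univ z) ?_
      unfold vw
      rw [cdec_eq_true hzK]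
      cases cdec (Conn ends (compl ω) s z)
      · exact hz.2
      · exact hz.1
    rw [hL]
    rcases not_and_or.1 (fun h => (not_conn_iff_of_open ends s hends he hsz).2 h hzK) with h | h
    · have hz' : Conn ends (Function.update ω e false) s z := not_not.1 h
      symm
      apply mul_eq_zero_of_right
      refine Finset.prod_eq_zero (Finset.mem_univ z) ?_
      rw [vw_loopAt, cdec_eq_true hz']
      cases cdec (Conn ends (Function.update (compl ω) e false) s z)
      · exact hz.2
      · exact hz.1
    · rw [notInd_of (not_not.1 h), zero_mul]
  · -- `z` is not reached: `y` is not reached with `e` closed, and every type is unchanged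
    obtain ⟨_, hy0⟩ := (not_conn_iff_of_open ends s hends he hsz).1 hzK
    rw [notInd_of_not hy0, one_mul]
    refine Finset.prod_congr rfl fun v _ => ?_
    rw [vw_loopAt, hupd]
    unfold vw
    rw [cdec_congr (conn_update_false_iff ends s hze hzK v)]

omit [Fintype E] [DecidableEq V] in
/-- **The per-colouring split, world 2.** -/
lemma prod_vw_split_false (W : V → TW) {z y : V} {e : E} (hends : ends e = s(z, y)) (hsz : s ≠ z)
    (hz : (W z).1 = 0 ∧ (W z).2.2.1 = 0) {ω : Config E} (he : ω e = false) :
    ∏ v : V, vw ends s W ω v =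
      notInd (Conn ends (Function.update (compl ω) e false) s y) *
        ∏ v : V, vw (loopAt ends e z) s W ω v := by
  have hze : z ∈ ends e := by rw [hends]; exact Sym2.mem_mk_left z y
  have hc : compl ω e = true := by simp [compl, he]
  have hupd : Function.update ω e false = ω := by
    conv_rhs => rw [← Function.update_eq_self e ω]
    rw [he]
  by_cases hzK : Conn ends (compl ω) s z
  · have hL : ∏ v : V, vw ends s W ω v = 0 := by
      refine Finset.prod_eq_zero (Finset.mem_univ z) ?_
      unfold vw
      rw [cdec_eq_true hzK]
      cases cdec (Conn ends ω s z)
      · exact hz.2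
      · exact hz.1
    rw [hL]
    rcases not_and_or.1 (fun h => (not_conn_iff_of_open ends s hends hc hsz).2 h hzK) with h | h
    · have hz' : Conn ends (Function.update (compl ω) e false) s z := not_not.1 h
      symm
      apply mul_eq_zero_of_right
      refine Finset.prod_eq_zero (Finset.mem_univ z) ?_
      rw [vw_loopAt, cdec_eq_true hz']
      cases cdec (Conn ends (Function.update ω e false) s z)
      · exact hz.2
      · exact hz.1
    · rw [notInd_of (not_not.1 h), zero_mul]
  · obtain ⟨_, hy0⟩ := (not_conn_iff_of_open ends s hends hc hsz).1 hzK
    rw [notInd_of_not hy0, one_mul]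
    refine Finset.prod_congr rfl fun v _ => ?_
    rw [vw_loopAt, hupd]
    unfold vw
    rw [cdec_congr (conn_update_false_iff ends s hze hzK v)]

/-- **The one-edge split of weighted counts**: if `z ≠ s` carries weight only on the type `O` and
`e = {z, y}` is an edge, then `2 · pcount_G W = pcount_{G'} (W[y ↦ W y ⊙ (0,1,1,2)])`, `G'` the graph
with `e` turned into a loop. -/
theorem pcount_split (W : V → TW) {z y : V} {e : E} (hends : ends e = s(z, y)) (hsz : s ≠ z)
    (hz : (W z).1 = 0 ∧ (W z).2.1 = 0 ∧ (W z).2.2.1 = 0) :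
    2 * pcount ends s W = pcount (loopAt ends e z) s (Function.update W y (tmul (W y) tSplit)) := by
  -- the two blind functions
  set f₁ : Config E → ℕ := fun ω =>
    notInd (Conn ends (Function.update ω e false) s y) *
      ∏ v : V, vw (loopAt ends e z) s W ω v with hf₁
  set f₂ : Config E → ℕ := fun ω =>
    notInd (Conn ends (Function.update (compl ω) e false) s y) *
      ∏ v : V, vw (loopAt ends e z) s W ω v with hf₂
  have hb : ∀ (ω : Config E) (b : Bool),
      ∏ v : V, vw (loopAt ends e z) s W (Function.update ω e b) v =
        ∏ v : V, vw (loopAt ends e z) s W ω v :=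
    fun ω b => Finset.prod_congr rfl fun v _ => vw_loopAt_update ends s W e z ω b v
  have hf₁b : ∀ ω b, f₁ (Function.update ω e b) = f₁ ω := by
    intro ω b
    simp only [hf₁, Function.update_idem, hb]
  have hf₂b : ∀ ω b, f₂ (Function.update ω e b) = f₂ ω := by
    intro ω b
    simp only [hf₂, compl_update_eq, Function.update_idem, hb]
  -- the count on `G`, split by the colour of `e`
  have hsplit : pcount ends s W =
      (∑ ω : Config E, if ω e = true then f₁ ω else 0) +
        ∑ ω : Config E, if ω e = false then f₂ ω else 0 := by
    unfold pcount
    rw [← Finset.sum_add_distrib]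
    refine Finset.sum_congr rfl fun ω _ => ?_
    cases he : ω e
    · rw [prod_vw_split_false ends s W hends hsz ⟨hz.1, hz.2.2⟩ he]; simp [hf₂]
    · rw [prod_vw_split_true ends s W hends hsz ⟨hz.1, hz.2.1⟩ he]; simp [hf₁]
  rw [hsplit, mul_add, sum_filter_eq_half f₁ e hf₁b true, sum_filter_eq_half f₂ e hf₂b false,
    ← Finset.sum_add_distrib]
  unfold pcount
  refine Finset.sum_congr rfl fun ω _ => ?_
  rw [prod_vw_update, tw_tmul, conn_loopAt_iff, conn_loopAt_iff, tw_tSplit_cdec]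
  simp only [hf₁, hf₂]
  rw [← Finset.mul_prod_erase Finset.univ _ (Finset.mem_univ y), vw_loopAt]
  ring

end ReimerVdBK
end Summit.Ventures.PercRepro2
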